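import Summits.AtomisticToContinuum.FouriersLaw.Theorems.VanishingNoiseTransferNoisyFourierFlipNessExists
import Summits.AtomisticToContinuum.FouriersLaw.Theorems.VanishingNoiseTransferNoisyFourierFlipSteadyStateHasSmoothDensity
import Summits.AtomisticToContinuum.FouriersLaw.Theorems.VanishingNoiseTransferNoisyFourierFlipSteadyStateEqBindResolventKernel

/-!
# Clause (i) of `NoisyFourier`: the flip steady state exists and is unique

Crux `VanishingNoiseTransfer.NoisyFourier` (stmt-AtomisticToContinuum-11977), line `sector-dirichlet-gluing`.
For the pinned anharmonic chain `pinnedChain ω₂ lam β γ` (`ω₂, lam, β, γ > 0`) with velocity flips at any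
rate `ε > 0`, `N` sites and Langevin baths at `T_L, T_R > 0`, the weak flip steady state
(`IsFlipSteadyState`: probability measure annihilating `L + εS` on `C_c^∞`) is unique
(`flipNessUnique`) and hence exists uniquely (`flipNessExistsUnique`, with the landed existence half
`stub_flipNessExists`). Uniqueness for `N ≥ 1`: by the two landed stubs every flip steady state has a
smooth density (`stub_flipSteadyState_hasSmoothDensity`, coupled Hörmander system) and satisfies the
resolvent identity `μ = (μQ) R_{Nε}` (`stub_flipSteadyState_eq_bind_resolventKernel`), so `μQ` is an
invariant probability measure of the embedded flip kernel `Q ∘ₖ R_{Nε}`, which has at most one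
(`pinnedChain_embeddedFlipKernel_invariant_unique`, Doeblin); `N = 0`: phase space is a point.
[cite: BernardinOlla2011, Prop 1] No definitions.
-/

noncomputable section

namespace Summit.AtomisticToContinuum.FouriersLaw.Cruxes.NoisyFourier.SectorDirichletGluing

open Filter Topology MeasureTheory
open Literature.MathematicalPhysics.KineticTheory.HeatConduction

/-- **Two weak flip steady states coincide** (all `N`, `T_L, T_R > 0`, every `ε > 0`). For `N ≥ 1`
both `μ` and `ν` equal `(·Q) R_{Nε}` of themselves, so `μQ` and `νQ` are invariant probability
measures of the embedded flip kernel `Q ∘ₖ R_{Nε}` and coincide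
(`pinnedChain_embeddedFlipKernel_invariant_unique`), whence `μ = (μQ)R = (νQ)R = ν`; for `N = 0`
phase space is a point. [cite: BernardinOlla2011, Prop 1] -/
theorem flipNessUnique :
    ∀ ω₂ lam β γ : ℝ, 0 < ω₂ → 0 < lam → 0 < β → 0 < γ → ∀ ε : ℝ, 0 < ε →
      ∀ (N : ℕ) (T_L T_R : ℝ), 0 < T_L → 0 < T_R →
        ∀ μ ν : MeasureTheory.Measure
            (Literature.MathematicalPhysics.KineticTheory.HeatConduction.PhaseSpace N),
          (Literature.MathematicalPhysics.KineticTheory.HeatConduction.pinnedChain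
              ω₂ lam β γ).IsFlipSteadyState N T_L T_R ε μ →
          (Literature.MathematicalPhysics.KineticTheory.HeatConduction.pinnedChain
              ω₂ lam β γ).IsFlipSteadyState N T_L T_R ε ν → μ = ν := by
  intro ω₂ lam β γ hω hl hβ hγ ε hε N T_L T_R hL hR μ ν hμ hν
  haveI := hμ.1
  haveI := hν.1
  rcases Nat.eq_zero_or_pos N with rfl | hN
  · -- `N = 0`: phase space is a point
    refine Measure.ext fun A _ => ?_
    rcases A.eq_empty_or_nonempty with rfl | hne
    · simp
    · rw [Subsingleton.eq_univ_of_nonempty hne, measure_univ, measure_univ]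
  · set S := pinnedChainSemigroup hω hl.le hβ.le hγ.le hN hL.le hR.le with hS
    have hr : 0 < (N : ℝ) * ε := by positivity
    haveI := S.isMarkovKernel_resolventKernel hr
    haveI := S.isMarkovKernel_embeddedFlipKernel hr
    have hμ' := stub_flipSteadyState_eq_bind_resolventKernel ω₂ lam β γ hω hl hβ hγ ε hε N T_L T_R hN
      hL hR μ hμ (stub_flipSteadyState_hasSmoothDensity ω₂ lam β γ hω hl hβ hγ ε hε N T_L T_R hN hL hR μ hμ)
    have hν' := stub_flipSteadyState_eq_bind_resolventKernel ω₂ lam β γ hω hl hβ hγ ε hε N T_L T_R hN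
      hL hR ν hν (stub_flipSteadyState_hasSmoothDensity ω₂ lam β γ hω hl hβ hγ ε hε N T_L T_R hN hL hR ν hν)
    -- `ρ Q` is invariant for the embedded flip kernel whenever `ρ = (ρ Q) R`
    have hinv : ∀ ρ : Measure (PhaseSpace N),
        ρ = (ρ.bind (flipKernel N)).bind (S.resolventKernel ((N : ℝ) * ε)) →
        ProbabilityTheory.Kernel.Invariant (S.embeddedFlipKernel ((N : ℝ) * ε))
          (ρ.bind (flipKernel N)) := by
      intro ρ h
      show (ρ.bind (flipKernel N)).bind (S.embeddedFlipKernel ((N : ℝ) * ε)) = ρ.bind (flipKernel N)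
      rw [S.embeddedFlipKernel_eq, ← Measure.comp_assoc]
      show ((ρ.bind (flipKernel N)).bind (S.resolventKernel ((N : ℝ) * ε))).bind (flipKernel N) =
        ρ.bind (flipKernel N)
      rw [← h]
    haveI : IsProbabilityMeasure (μ.bind (flipKernel N)) := by infer_instance
    haveI : IsProbabilityMeasure (ν.bind (flipKernel N)) := by infer_instance
    have hQ : μ.bind (flipKernel N) = ν.bind (flipKernel N) :=
      pinnedChain_embeddedFlipKernel_invariant_unique hω hl.le hβ hγ hN hL hR hr (hinv μ hμ') (hinv ν hν')
    rw [hμ', hν', hQ]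

/-- **Clause (i) of `NoisyFourier`: for every `ε > 0` the weak flip steady state exists and is unique**
(`ω₂, lam, β, γ > 0`, all `N`, `T_L, T_R > 0`), from the landed existence half `stub_flipNessExists`
(embedded chain at the flip times + discrete Krylov–Bogoliubov) and `flipNessUnique`.
[cite: BernardinOlla2011, Prop 1] -/
theorem flipNessExistsUnique :
    ∀ ω₂ lam β γ : ℝ, 0 < ω₂ → 0 < lam → 0 < β → 0 < γ → ∀ ε : ℝ, 0 < ε →
      ∀ (N : ℕ) (T_L T_R : ℝ), 0 < T_L → 0 < T_R →
        ∃! μ : MeasureTheory.Measure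
            (Literature.MathematicalPhysics.KineticTheory.HeatConduction.PhaseSpace N),
          (Literature.MathematicalPhysics.KineticTheory.HeatConduction.pinnedChain
              ω₂ lam β γ).IsFlipSteadyState N T_L T_R ε μ :=
  fun ω₂ lam β γ hω hl hβ hγ ε hε N T_L T_R hL hR =>
    existsUnique_of_exists_of_unique (stub_flipNessExists ω₂ lam β γ hω hl hβ hγ ε hε N T_L T_R hL hR)
      fun μ ν hμ hν => flipNessUnique ω₂ lam β γ hω hl hβ hγ ε hε N T_L T_R hL hR μ ν hμ hν

end Summit.AtomisticToContinuum.FouriersLaw.Cruxes.NoisyFourier.SectorDirichletGluing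

end
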